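import Summits.Ventures.Crystal3D.Theorems.StickyWulffConstantNoReconstructionGainCapFrameGain
import Summits.Ventures.Crystal3D.Theorems.StickyWulffConstantNoReconstructionGainSymmetry
import HarnessLib

/-!
# The 18-direction BARLOW STAR: a registration frame in which every Barlow bond is registered

HONEST FRAMING. Part of the venture `Summits/Ventures/Crystal3D` (cell `crystal3d-full`), helper
`--supports` the crux `NoReconstructionGain` (stmt-Ventures-19144, route
`route-Ventures-StickyWulffConstant`), line `adhesion` (wulff-p1 g10); the frame promised in
`…CapFrameLocal` / `…CapFrameGain` for one-plate adhesion on BARLOW substrates (T line,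
`stub_barlowAdhesionR`) and for twin / fault lamellae parallel to the basal plane.

The fcc bond star (the twelve unit vectors of `Λ₀ = fccStacking 1 √(2/3)`, basal plane horizontal)
together with the basal mirror images `v ↦ v − 2⟪v, e₃⟫ e₃` of its six out-of-plane members: 18
unit vectors — 6 in-plane, 3 + 3 up (fcc-type and twin-type hollows), 3 + 3 down.  Every bond of
every Barlow stacking with horizontal layers is one of them (a bilayer is either of fcc type or of
twin type).  Closest pair: an fcc-type and a twin-type out-of-plane direction on the same side,
`⟪d, d'⟫ = 5/6` (`33.56°`), so with cap threshold `c = √(11/12)` (`cos 16.78°`, `2c² − 1 = 5/6`,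
`c ≥ √3/2`) the caps are pairwise disjoint and `…CapFrameLocal` / `frameGain_eq` apply with the
frame constant `(18 − 12)/2 = 3` per film ball.

* `inner_basalMirror`, `inner_basalMirror_basalMirror` — the mirror is an isometry;
* `fcc_inner_ge_half_of_same_height` — two unit vectors of `Λ₀` at the same nonzero basal height
  `±√(2/3)` have `⟪d, w⟫ ≥ 1/2` (horizontal Cauchy–Schwarz + half-integrality of `⟪Λ₀, Λ₀⟫`);
* `barlowStar_frame` — for `U` = fcc star ∪ mirrored out-of-plane star: all members are unit,
  `U = −U`, distinct members have `⟪d, d'⟫ ≤ 2(√(11/12))² − 1`, `#U = 18`, and `√3/2 ≤ √(11/12)`.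

WHAT THIS IS NOT: the Barlow rim lemma (substrate balls in outward caps of film balls off the rim)
nor the bond-membership lemma for a general Hägg word — both are the T line's to state in its moved
frames; rung F-C1 not moved.
-/

noncomputable section

namespace Summit.Ventures.Crystal3D.Theorems

open Summit.Ventures.Crystal3D Finset
open Literature.MathematicalPhysics.StatisticalMechanics (barlowPos fccStacking constHagg barlowPos_apply_two)
open scoped InnerProductSpace

/-- `⟪d, v − 2⟪v,e⟫e⟫ = ⟪d, v⟫ − 2⟪v,e⟫⟪d,e⟫`. -/
theorem inner_basalMirror (d v e : EuclideanSpace ℝ (Fin 3)) :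
    ⟪d, v - (2 * ⟪v, e⟫_ℝ) • e⟫_ℝ = ⟪d, v⟫_ℝ - 2 * ⟪v, e⟫_ℝ * ⟪d, e⟫_ℝ := by
  rw [inner_sub_right, inner_smul_right]

/-- The basal mirror about a unit vector `e` preserves inner products. -/
theorem inner_basalMirror_basalMirror (v w e : EuclideanSpace ℝ (Fin 3)) (he : ‖e‖ = 1) :
    ⟪v - (2 * ⟪v, e⟫_ℝ) • e, w - (2 * ⟪w, e⟫_ℝ) • e⟫_ℝ = ⟪v, w⟫_ℝ := by
  have hee : ⟪e, e⟫_ℝ = 1 := by rw [real_inner_self_eq_norm_sq, he, one_pow]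
  rw [inner_sub_left, inner_sub_right, inner_sub_right, inner_smul_left, inner_smul_right, inner_smul_left,
    inner_smul_right, hee, real_inner_comm e w]
  simp only [conj_trivial]; ring

/-- **Two unit vectors of `Λ₀` at the same basal height `±√(2/3)` make an angle `≤ 60°`.**
(`⟪d, w⟫ ≥ ⟪d,e₃⟫⟪w,e₃⟫ − ‖d_h‖‖w_h‖ = 2/3 − 1/3`, and `2⟪d, w⟫ ∈ ℤ`.) -/
theorem fcc_inner_ge_half_of_same_height {d w : EuclideanSpace ℝ (Fin 3)}
    (hd : d ∈ fccStacking 1 (Real.sqrt (2 / 3))) (hw : w ∈ fccStacking 1 (Real.sqrt (2 / 3)))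
    (hdn : ‖d‖ = 1) (hwn : ‖w‖ = 1)
    (hz : ⟪d, EuclideanSpace.single (2 : Fin 3) (1 : ℝ)⟫_ℝ = ⟪w, EuclideanSpace.single (2 : Fin 3) (1 : ℝ)⟫_ℝ)
    (hz2 : ⟪d, EuclideanSpace.single (2 : Fin 3) (1 : ℝ)⟫_ℝ ^ 2 = 2 / 3) : 1 / 2 ≤ ⟪d, w⟫_ℝ := by
  set e : EuclideanSpace ℝ (Fin 3) := EuclideanSpace.single (2 : Fin 3) (1 : ℝ) with he
  have hen : ‖e‖ = 1 := by simp [he]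
  have hee : ⟪e, e⟫_ℝ = 1 := by rw [real_inner_self_eq_norm_sq, hen, one_pow]
  set a := ⟪d, e⟫_ℝ with ha
  set x := d - a • e with hx
  set y := w - a • e with hy
  have hx2 : ‖x‖ ^ 2 = 1 / 3 := by
    rw [hx, norm_sub_sq_real, hdn, norm_smul, Real.norm_eq_abs, hen, mul_one, sq_abs, inner_smul_right, ← ha]
    nlinarith [hz2]
  have hy2 : ‖y‖ ^ 2 = 1 / 3 := by
    rw [hy, norm_sub_sq_real, hwn, norm_smul, Real.norm_eq_abs, hen, mul_one, sq_abs, inner_smul_right, ← hz]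
    nlinarith [hz2]
  have hxy : ⟪x, y⟫_ℝ = ⟪d, w⟫_ℝ - a ^ 2 := by
    rw [hx, hy, inner_sub_left, inner_sub_right, inner_sub_right, inner_smul_left, inner_smul_right,
      inner_smul_left, inner_smul_right, real_inner_comm w e, ← hz, ← ha, hee]
    simp only [conj_trivial]; ring
  have hcs : |⟪x, y⟫_ℝ| ≤ ‖x‖ * ‖y‖ := abs_real_inner_le_norm x y
  have hxn : ‖x‖ ^ 2 * ‖y‖ ^ 2 = 1 / 9 := by rw [hx2, hy2]; norm_num
  have hprod : ‖x‖ * ‖y‖ = 1 / 3 := by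
    have h0 : 0 ≤ ‖x‖ * ‖y‖ := mul_nonneg (norm_nonneg _) (norm_nonneg _)
    nlinarith [hxn]
  have hge : 1 / 3 ≤ ⟪d, w⟫_ℝ := by
    have := (abs_le.1 (hcs.trans hprod.le)).1
    nlinarith [hz2]
  obtain ⟨n, hn⟩ := exists_int_two_inner_fcc hd hw
  have hn1 : (1 : ℤ) ≤ n := by
    have : (2 : ℝ) / 3 ≤ n := by rw [← hn]; linarith
    have : (0 : ℝ) < n := by linarith
    have h0 : (0 : ℤ) < n := by exact_mod_cast this
    omega
  have : (1 : ℝ) ≤ n := by exact_mod_cast hn1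
  linarith

/-- **The 18-direction Barlow star is a separated frame with threshold `√(11/12)`.** -/
theorem barlowStar_frame (U : Finset (EuclideanSpace ℝ (Fin 3)))
    (hUdef : U =
      ([barlowPos 1 (Real.sqrt (2 / 3)) constHagg 0 1 0, -barlowPos 1 (Real.sqrt (2 / 3)) constHagg 0 1 0,
        barlowPos 1 (Real.sqrt (2 / 3)) constHagg 0 0 1, -barlowPos 1 (Real.sqrt (2 / 3)) constHagg 0 0 1,
        barlowPos 1 (Real.sqrt (2 / 3)) constHagg 0 1 (-1), -barlowPos 1 (Real.sqrt (2 / 3)) constHagg 0 1 (-1),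
        barlowPos 1 (Real.sqrt (2 / 3)) constHagg 1 0 0, -barlowPos 1 (Real.sqrt (2 / 3)) constHagg 1 0 0,
        barlowPos 1 (Real.sqrt (2 / 3)) constHagg (-1) 1 0, -barlowPos 1 (Real.sqrt (2 / 3)) constHagg (-1) 1 0,
        barlowPos 1 (Real.sqrt (2 / 3)) constHagg (-1) 0 1, -barlowPos 1 (Real.sqrt (2 / 3)) constHagg (-1) 0 1] :
        List (EuclideanSpace ℝ (Fin 3))).toFinset ∪
      (([barlowPos 1 (Real.sqrt (2 / 3)) constHagg 1 0 0, -barlowPos 1 (Real.sqrt (2 / 3)) constHagg 1 0 0,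
        barlowPos 1 (Real.sqrt (2 / 3)) constHagg (-1) 1 0, -barlowPos 1 (Real.sqrt (2 / 3)) constHagg (-1) 1 0,
        barlowPos 1 (Real.sqrt (2 / 3)) constHagg (-1) 0 1, -barlowPos 1 (Real.sqrt (2 / 3)) constHagg (-1) 0 1] :
        List (EuclideanSpace ℝ (Fin 3))).toFinset).image fun v =>
          v - (2 * ⟪v, EuclideanSpace.single (2 : Fin 3) (1 : ℝ)⟫_ℝ) • EuclideanSpace.single (2 : Fin 3) (1 : ℝ)) :
    (∀ d ∈ U, ‖d‖ = 1) ∧ (∀ d ∈ U, -d ∈ U) ∧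
      (∀ d ∈ U, ∀ d' ∈ U, d ≠ d' → ⟪d, d'⟫_ℝ ≤ 2 * Real.sqrt (11 / 12) ^ 2 - 1) ∧
      U.card = 18 ∧ Real.sqrt 3 / 2 ≤ Real.sqrt (11 / 12) := by
  classical
  set e : EuclideanSpace ℝ (Fin 3) := EuclideanSpace.single (2 : Fin 3) (1 : ℝ) with he
  set S : Finset (EuclideanSpace ℝ (Fin 3)) :=
    ([barlowPos 1 (Real.sqrt (2 / 3)) constHagg 0 1 0, -barlowPos 1 (Real.sqrt (2 / 3)) constHagg 0 1 0,
        barlowPos 1 (Real.sqrt (2 / 3)) constHagg 0 0 1, -barlowPos 1 (Real.sqrt (2 / 3)) constHagg 0 0 1,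
        barlowPos 1 (Real.sqrt (2 / 3)) constHagg 0 1 (-1), -barlowPos 1 (Real.sqrt (2 / 3)) constHagg 0 1 (-1),
        barlowPos 1 (Real.sqrt (2 / 3)) constHagg 1 0 0, -barlowPos 1 (Real.sqrt (2 / 3)) constHagg 1 0 0,
        barlowPos 1 (Real.sqrt (2 / 3)) constHagg (-1) 1 0, -barlowPos 1 (Real.sqrt (2 / 3)) constHagg (-1) 1 0,
        barlowPos 1 (Real.sqrt (2 / 3)) constHagg (-1) 0 1, -barlowPos 1 (Real.sqrt (2 / 3)) constHagg (-1) 0 1] :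
        List (EuclideanSpace ℝ (Fin 3))).toFinset with hS
  set O : Finset (EuclideanSpace ℝ (Fin 3)) :=
    ([barlowPos 1 (Real.sqrt (2 / 3)) constHagg 1 0 0, -barlowPos 1 (Real.sqrt (2 / 3)) constHagg 1 0 0,
        barlowPos 1 (Real.sqrt (2 / 3)) constHagg (-1) 1 0, -barlowPos 1 (Real.sqrt (2 / 3)) constHagg (-1) 1 0,
        barlowPos 1 (Real.sqrt (2 / 3)) constHagg (-1) 0 1, -barlowPos 1 (Real.sqrt (2 / 3)) constHagg (-1) 0 1] :
        List (EuclideanSpace ℝ (Fin 3))).toFinset with hO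
  set R : EuclideanSpace ℝ (Fin 3) → EuclideanSpace ℝ (Fin 3) := fun v => v - (2 * ⟪v, e⟫_ℝ) • e with hR
  have hU : U = S ∪ O.image R := hUdef
  -- constants
  have hen : ‖e‖ = 1 := by simp [he]
  have hine : ∀ u : EuclideanSpace ℝ (Fin 3), ⟪u, e⟫_ℝ = u 2 := fun u => by
    simp [he, EuclideanSpace.inner_single_right]
  have hh2 : Real.sqrt (2 / 3) ^ 2 = 2 / 3 := Real.sq_sqrt (by norm_num)
  have hc2 : Real.sqrt (11 / 12) ^ 2 = 11 / 12 := Real.sq_sqrt (by norm_num)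
  have hc3 : Real.sqrt 3 / 2 ≤ Real.sqrt (11 / 12) := by
    rw [show Real.sqrt 3 / 2 = Real.sqrt (3 / 4) by
      rw [Real.sqrt_div' 3 (by norm_num : (0:ℝ) ≤ 4), show Real.sqrt 4 = 2 by
        rw [show (4:ℝ) = 2 ^ 2 by norm_num, Real.sqrt_sq (by norm_num)]]]
    exact Real.sqrt_le_sqrt (by norm_num)
  -- the fcc star: members, negation, heights; `O ⊆ S` and out of plane
  have hSmem : ∀ d ∈ S, d ∈ fccStacking 1 (Real.sqrt (2 / 3)) ∧ ‖d‖ = 1 := fun d hd => fccBondStar_mem hd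
  have hSneg : ∀ d ∈ S, -d ∈ S := fun d hd => fccBondStar_neg_mem hd
  have hOS : O ⊆ S := by
    intro v hv
    rw [hO, List.mem_toFinset] at hv
    rw [hS, List.mem_toFinset]
    simp only [List.mem_cons, List.mem_nil_iff, or_false] at hv ⊢
    rcases hv with rfl | rfl | rfl | rfl | rfl | rfl <;> simp
  have hOneg : ∀ v ∈ O, -v ∈ O := by
    intro v hv
    rw [hO, List.mem_toFinset] at hv ⊢
    simp only [List.mem_cons, List.mem_nil_iff, or_false] at hv ⊢
    rcases hv with rfl | rfl | rfl | rfl | rfl | rfl <;> simp only [neg_neg, true_or, or_true]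
  have hbe0 : ∀ i j : ℤ, ⟪barlowPos 1 (Real.sqrt (2 / 3)) constHagg 0 i j, e⟫_ℝ = 0 := fun i j => by
    rw [hine, barlowPos_apply_two]; push_cast; ring
  have hbe1 : ∀ i j : ℤ, ⟪barlowPos 1 (Real.sqrt (2 / 3)) constHagg 1 i j, e⟫_ℝ = Real.sqrt (2 / 3) := fun i j => by
    rw [hine, barlowPos_apply_two]; push_cast; ring
  have hbem : ∀ i j : ℤ, ⟪barlowPos 1 (Real.sqrt (2 / 3)) constHagg (-1) i j, e⟫_ℝ = -Real.sqrt (2 / 3) :=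
    fun i j => by rw [hine, barlowPos_apply_two]; push_cast; ring
  have hh2' : (-Real.sqrt (2 / 3)) ^ 2 = 2 / 3 := by rw [neg_sq]; exact hh2
  have hOz : ∀ v ∈ O, ⟪v, e⟫_ℝ ^ 2 = 2 / 3 := by
    intro v hv
    rw [hO, List.mem_toFinset] at hv
    simp only [List.mem_cons, List.mem_nil_iff, or_false] at hv
    rcases hv with rfl | rfl | rfl | rfl | rfl | rfl <;>
      simp only [inner_neg_left, hbe1, hbem, neg_neg] <;> first | exact hh2 | exact hh2'
  have hSz : ∀ d ∈ S, ⟪d, e⟫_ℝ = 0 ∨ ⟪d, e⟫_ℝ ^ 2 = 2 / 3 := by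
    intro d hd
    rw [hS, List.mem_toFinset] at hd
    simp only [List.mem_cons, List.mem_nil_iff, or_false] at hd
    rcases hd with rfl | rfl | rfl | rfl | rfl | rfl | rfl | rfl | rfl | rfl | rfl | rfl <;>
      simp only [inner_neg_left, hbe0, hbe1, hbem, neg_neg, neg_zero, true_or] <;>
      first
      | exact Or.inl rfl
      | exact Or.inl trivial
      | exact Or.inr hh2
      | exact Or.inr hh2'
  -- key mixed estimate: `⟪d, R v⟫ ≤ 5/6` for `d ∈ S`, `v ∈ O`
  have hmix : ∀ d ∈ S, ∀ v ∈ O, ⟪d, R v⟫_ℝ ≤ 5 / 6 := by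
    intro d hd v hv
    obtain ⟨hdΛ, hdn⟩ := hSmem d hd
    obtain ⟨hvΛ, hvn⟩ := hSmem v (hOS hv)
    have hvz := hOz v hv
    have hRv : ⟪d, R v⟫_ℝ = ⟪d, v⟫_ℝ - 2 * ⟪v, e⟫_ℝ * ⟪d, e⟫_ℝ := inner_basalMirror d v e
    rw [hRv]
    have hdv1 : ⟪d, v⟫_ℝ ≤ 1 := by
      have := abs_real_inner_le_norm d v; rw [hdn, hvn] at this; exact (abs_le.1 (by linarith)).2
    set a := ⟪d, e⟫_ℝ with ha
    set b := ⟪v, e⟫_ℝ with hb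
    rcases hSz d hd with hz0 | hz2
    · -- in-plane `d`: `d ≠ v`
      rw [← ha] at hz0
      rw [hz0, mul_zero, sub_zero]
      have hne : d ≠ v := fun h => by
        have : b = 0 := by rw [hb, ← h]; exact hz0
        rw [this] at hvz; norm_num at hvz
      linarith only [real_inner_le_half_of_fcc_unit hdΛ hvΛ hdn hvn hne]
    · -- out-of-plane `d`: same sign or opposite sign
      rw [← ha] at hz2
      have hprod : (b * a) ^ 2 = 4 / 9 := by rw [mul_pow, hvz, hz2]; norm_num
      have hpm : b * a = 2 / 3 ∨ b * a = -(2 / 3) := by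
        have h0 : (b * a - 2 / 3) * (b * a + 2 / 3) = 0 := by
          have : (b * a - 2 / 3) * (b * a + 2 / 3) = (b * a) ^ 2 - 4 / 9 := by ring
          rw [this, hprod]; norm_num
        rcases mul_eq_zero.1 h0 with h | h
        · left; linarith only [h]
        · right; linarith only [h]
      rcases hpm with hsame | hopp
      · linarith only [hsame, hdv1]
      · -- opposite heights: `-v` is at the height of `d`, so `⟪d, -v⟫ ≥ 1/2`
        have hzeq : a = ⟪-v, e⟫_ℝ := by
          rw [inner_neg_left, ← hb]
          have hsq : (a + b) ^ 2 = 0 := by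
            have : (a + b) ^ 2 = a ^ 2 + 2 * (b * a) + b ^ 2 := by ring
            rw [this, hz2, hvz, hopp]; norm_num
          have h0 : a + b = 0 := by
            rcases (pow_eq_zero_iff two_ne_zero).1 hsq |> Or.inl with h | h <;> exact h
          linarith only [h0]
        have hge := fcc_inner_ge_half_of_same_height hdΛ (fcc_neg_mem hvΛ) hdn (by rw [norm_neg, hvn]) hzeq hz2
        rw [inner_neg_right] at hge
        linarith only [hopp, hge]
  -- `R v ∉ S`
  have hRnot : ∀ v ∈ O, R v ∉ S := by
    intro v hv hmem
    have h := hmix (R v) hmem v hv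
    have hn : ⟪R v, R v⟫_ℝ = 1 := by
      rw [hR]; simp only []
      rw [inner_basalMirror_basalMirror v v e hen, real_inner_self_eq_norm_sq, (hSmem v (hOS hv)).2, one_pow]
    linarith
  have hee : ⟪e, e⟫_ℝ = 1 := by rw [real_inner_self_eq_norm_sq, hen, one_pow]
  have hRR : ∀ u, R (R u) = u := by
    intro u
    simp only [hR]
    rw [inner_sub_left, inner_smul_left, hee]
    simp only [conj_trivial, mul_one]
    module
  have hRinj : Function.Injective R := by
    intro v w hvw
    have h := congrArg R hvw
    rwa [hRR, hRR] at h
  refine ⟨?_, ?_, ?_, ?_, hc3⟩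
  · -- unit
    intro d hd
    rw [hU, mem_union] at hd
    rcases hd with hd | hd
    · exact (hSmem d hd).2
    · obtain ⟨v, hv, rfl⟩ := mem_image.1 hd
      have hn : ⟪R v, R v⟫_ℝ = 1 := by
        rw [hR]; simp only []
        rw [inner_basalMirror_basalMirror v v e hen, real_inner_self_eq_norm_sq, (hSmem v (hOS hv)).2, one_pow]
      rw [real_inner_self_eq_norm_sq] at hn
      nlinarith [norm_nonneg (R v)]
  · -- negation
    intro d hd
    rw [hU, mem_union] at hd ⊢
    rcases hd with hd | hd
    · exact Or.inl (hSneg d hd)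
    · obtain ⟨v, hv, rfl⟩ := mem_image.1 hd
      refine Or.inr (mem_image.2 ⟨-v, hOneg v hv, ?_⟩)
      simp only [hR, inner_neg_left]
      module
  · -- separation
    intro d hd d' hd' hne
    rw [hc2]
    norm_num
    rw [hU, mem_union] at hd hd'
    rcases hd with hd | hd <;> rcases hd' with hd' | hd'
    · linarith [real_inner_le_half_of_fcc_unit (hSmem d hd).1 (hSmem d' hd').1 (hSmem d hd).2 (hSmem d' hd').2 hne]
    · obtain ⟨v, hv, rfl⟩ := mem_image.1 hd'
      exact hmix d hd v hv
    · obtain ⟨v, hv, rfl⟩ := mem_image.1 hd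
      rw [real_inner_comm]; exact hmix d' hd' v hv
    · obtain ⟨v, hv, rfl⟩ := mem_image.1 hd
      obtain ⟨w, hw, rfl⟩ := mem_image.1 hd'
      have hvw : v ≠ w := fun h => hne (by rw [h])
      rw [show ⟪R v, R w⟫_ℝ = ⟪v, w⟫_ℝ from inner_basalMirror_basalMirror v w e hen]
      linarith [real_inner_le_half_of_fcc_unit (hSmem v (hOS hv)).1 (hSmem w (hOS hw)).1 (hSmem v (hOS hv)).2
        (hSmem w (hOS hw)).2 hvw]
  · -- cardinality
    have hScard : S.card = 12 := fccBondStar_card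
    have hOcard : O.card = 6 := by
      have key : ([barlowPos 1 (Real.sqrt (2 / 3)) constHagg 1 0 0, -barlowPos 1 (Real.sqrt (2 / 3)) constHagg 1 0 0,
          barlowPos 1 (Real.sqrt (2 / 3)) constHagg (-1) 1 0, -barlowPos 1 (Real.sqrt (2 / 3)) constHagg (-1) 1 0,
          barlowPos 1 (Real.sqrt (2 / 3)) constHagg (-1) 0 1, -barlowPos 1 (Real.sqrt (2 / 3)) constHagg (-1) 0 1] : List (EuclideanSpace ℝ (Fin 3))) =
          ([((1 : ℤ), (0 : ℤ), (0 : ℤ)), (-1, 0, 0), (-1, 1, 0), (1, -1, 0), (-1, 0, 1), (1, 0, -1)] :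
            List (ℤ × ℤ × ℤ)).map fun t => barlowPos 1 (Real.sqrt (2 / 3)) constHagg t.1 t.2.1 t.2.2 := by
        simp only [List.map_cons, List.map_nil, ← barlowPos_fcc_neg]
        norm_num
      rw [hO, key, List.toFinset_card_of_nodup]
      · simp
      · refine List.Nodup.map (fun s t hst => ?_) (by decide)
        have h := barlowPos_fcc_injective hst
        obtain ⟨h1, h2⟩ := Prod.mk.inj h
        obtain ⟨h2, h3⟩ := Prod.mk.inj h2
        exact Prod.ext h1 (Prod.ext h2 h3)
    have hdisj : Disjoint S (O.image R) := by
      rw [disjoint_left]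
      intro d hdS hdI
      obtain ⟨v, hv, rfl⟩ := mem_image.1 hdI
      exact hRnot v hv hdS
    rw [hU, card_union_of_disjoint hdisj, hScard, card_image_of_injective _ hRinj, hOcard]

end Summit.Ventures.Crystal3D.Theorems

end
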